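import Literature.Analysis.FluidPDE.TorusLatticeNorms
import Literature.Analysis.FunctionSpaces.TorusTrilinearH1
import HarnessLib

/-!
# Trilinear bounds for the convective derivative on `T³` in lattice form

Analysis/FluidPDE support file for the energy-method construction of Euler flows in the
periodic cylinder (`Literature.Analysis.FluidPDE.KatoLai1984_periodicCylinderUniformExistence`;
Kato–Lai 1984, §4 (4.2)–(4.5), "more or less well known"). For smooth real fields on the flat
torus `T^d`, `card d = 3`, with the lattice energies `latNormSq` of `TorusLatticeNorms`:

* `integral_inner_convect_self_eq` — **the transport identity with divergence**:
  `∫ ⟪(W·∇)V, V⟫ = -½ ∫ ‖V‖² div W` (no solenoidality assumed), and its consequence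
  `abs_integral_inner_convect_self_le_of_div` (`≤ ½ ‖div W‖_∞ ∫ ‖V‖²`);
* `exists_abs_divergence_le` — `‖div W‖_∞ ≤ C √(latNormSq 3 W)` (`H² ⊂ L^∞` on `∂W`);
* `exists_sup_norm_le`, `exists_sup_norm_partialDeriv_le` — `‖A‖_∞ ≤ C √(latNormSq 2 A)`,
  `‖∂ⱼ B‖_∞ ≤ C √(latNormSq 3 B)`;
* three **trilinear bounds** for `|∫ ⟪(A·∇)B, z⟫|` by `‖z‖_{L²}` times:
  `C √(latNormSq 2 A) √(latNormSq 1 B)` (sup on `A`; `exists_trilinear_sup_left`),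
  `C √(latNormSq 0 A) √(latNormSq 3 B)` (sup on `∇B`; `exists_trilinear_sup_right`),
  `C √(latNormSq 1 A) √(latNormSq 2 B)` (`L⁴ × L⁴`, `exists_trilinear_L4`);
* `latProd_le_tame` — **the tame pairing of levels**: for `3 ≤ p, q` with `p + q = m + 3`,
  `latNormSq p W · latNormSq q U ≤ latNormSq 3 W · latNormSq m U + latNormSq m W · latNormSq 3 U`
  (log-convexity in the level and Young's inequality).

Everything is proved; no named fact and no `sorry` is introduced. Constants are existential.

## Mathlib / tree search

Tree: `Torus.integral_inner_gradient_eq_neg_integral_mul_divergence_holds`,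
`Torus.fderiv_norm_sq_apply`, `Torus.inner_gradient_left`, `Torus.norm_convect_le`
(`TorusCalculusProofs`, `TorusFourierModes`); `GalerkinSmooth.integral_norm_mul_norm_le`,
`GalerkinSmooth.abs_integral_inner_convect_le_of_sup_left/right` (`GalerkinSmoothHm`);
`Torus.latNormSq_*` (`TorusLatticeNorms`). Mathlib: `Real.geom_mean_le_arith_mean2_weighted`.

## References

* T. Kato, C. Y. Lai, J. Funct. Anal. 56 (1984) 15–28, §4. [KatoLai1984]
* A. J. Majda, A. L. Bertozzi, *Vorticity and Incompressible Flow*, CUP 2002, §3.2, Prop. 3.7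
  (calculus inequalities of the `H^m` energy estimate). [MajdaBertozziCUP2002]
-/

noncomputable section

open Filter Topology TopologicalSpace Finset MeasureTheory UnitAddTorus
open scoped ENNReal NNReal InnerProductSpace

namespace Literature.Analysis.FluidPDE

namespace Torus

open FunctionSpaces FunctionSpaces.Torus GalerkinSmooth

universe u

variable {d : Type u} [Fintype d] [DecidableEq d]

/-! ### The transport identity with divergence -/

section Transport

variable {W : UnitAddTorus d → EuclideanSpace ℝ d}
variable {G : Type*} [NormedAddCommGroup G] [InnerProductSpace ℝ G] {V : UnitAddTorus d → G}

/-- **`∫ ⟪(W·∇)V, V⟫ = -½ ∫ ‖V‖² div W`** for smooth `W`, `V` on the torus. [folklore] -/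
theorem integral_inner_convect_self_eq (hW : IsSmooth W) (hV : IsSmooth V) :
    ∫ x, ⟪Torus.convect W V x, V x⟫_ℝ = -(2⁻¹ * ∫ x, ‖V x‖ ^ 2 * Torus.divergence W x) := by
  have hV1 : IsContDiff 1 V := hV.isContDiff (by simp)
  have hpt : ∀ x, ⟪Torus.convect W V x, V x⟫_ℝ = 2⁻¹ * ⟪W x, Torus.gradient (fun y => ‖V y‖ ^ 2) x⟫_ℝ := by
    intro x
    rw [show ⟪W x, Torus.gradient (fun y => ‖V y‖ ^ 2) x⟫_ℝ = ⟪Torus.gradient (fun y => ‖V y‖ ^ 2) x, W x⟫_ℝ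
      from real_inner_comm _ _, Torus.inner_gradient_left, fderiv_norm_sq_apply hV1, Torus.convect, real_inner_comm]
    ring
  simp_rw [hpt]
  rw [integral_const_mul, integral_inner_gradient_eq_neg_integral_mul_divergence_holds hW hV.norm_sq]
  ring

/-- **`|∫ ⟪(W·∇)V, V⟫| ≤ ½ ‖div W‖_∞ ∫ ‖V‖²`.** [folklore] -/
theorem abs_integral_inner_convect_self_le_of_div (hW : IsSmooth W) (hV : IsSmooth V) {D : ℝ}
    (hD : ∀ x, |Torus.divergence W x| ≤ D) :
    |∫ x, ⟪Torus.convect W V x, V x⟫_ℝ| ≤ 2⁻¹ * D * ∫ x, ‖V x‖ ^ 2 := by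
  have hD0 : 0 ≤ D := (abs_nonneg _).trans (hD 0)
  have hint : Integrable (fun x => ‖V x‖ ^ 2 * Torus.divergence W x) volume :=
    (hV.norm_sq.continuous.mul (IsSmooth.divergence hW).continuous).integrable_unitAddTorus
  have hint2 : Integrable (fun x => ‖V x‖ ^ 2) volume := hV.norm_sq.continuous.integrable_unitAddTorus
  rw [integral_inner_convect_self_eq hW hV, abs_neg, abs_mul, abs_of_pos (by norm_num : (0 : ℝ) < 2⁻¹),
    mul_assoc]
  refine mul_le_mul_of_nonneg_left ?_ (by norm_num)
  calc |∫ x, ‖V x‖ ^ 2 * Torus.divergence W x| ≤ ∫ x, |‖V x‖ ^ 2 * Torus.divergence W x| := abs_integral_le_integral_abs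
    _ ≤ ∫ x, D * ‖V x‖ ^ 2 := by
        refine integral_mono_of_nonneg (ae_of_all _ fun x => abs_nonneg _) (hint2.const_mul D)
          (ae_of_all _ fun x => ?_)
        show |‖V x‖ ^ 2 * Torus.divergence W x| ≤ D * ‖V x‖ ^ 2
        rw [abs_mul, abs_of_nonneg (sq_nonneg _), mul_comm]
        exact mul_le_mul_of_nonneg_right (hD x) (sq_nonneg _)
    _ = D * ∫ x, ‖V x‖ ^ 2 := integral_const_mul _ _

end Transport

/-! ### Sup norms in lattice form -/

section Sup

variable {W : UnitAddTorus d → EuclideanSpace ℝ d}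

/-- `|div W (x)| ≤ ∑ᵢ ‖∂ᵢ W (x)‖`. [folklore] -/
theorem abs_divergence_le_sum (hW : IsSmooth W) (x : UnitAddTorus d) :
    |Torus.divergence W x| ≤ ∑ i, ‖Torus.partialDeriv i W x‖ := by
  unfold Torus.divergence
  refine (abs_sum_le_sum_abs _ _).trans (sum_le_sum fun i _ => ?_)
  have h : Torus.partialDeriv i (fun y => W y i) x = (Torus.partialDeriv i W x) i := by
    have := partialDeriv_clm_comp hW (EuclideanSpace.proj i) i x
    exact this
  rw [h, ← Real.norm_eq_abs]
  exact PiLp.norm_apply_le _ i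

/-- **`‖A‖_∞ ≤ C √(latNormSq 2 A)`** on `T³`. [folklore] -/
theorem exists_sup_norm_le (hd : Fintype.card d = 3) : ∃ C : ℝ, 0 ≤ C ∧
    ∀ A : UnitAddTorus d → EuclideanSpace ℝ d, IsSmooth A → ∀ x, ‖A x‖ ≤ C * Real.sqrt (latNormSq 2 A) := by
  obtain ⟨K, hK0, hK⟩ := exists_norm_sq_le_latNormSq_two (d := d) hd
  refine ⟨Real.sqrt K, Real.sqrt_nonneg _, fun A hA x => ?_⟩
  rw [← Real.sqrt_mul hK0, ← Real.sqrt_sq (norm_nonneg (A x))]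
  exact Real.sqrt_le_sqrt (hK A hA x)

/-- **`‖∂ⱼ B‖_∞ ≤ C √(latNormSq 3 B)`** on `T³`. [folklore] -/
theorem exists_sup_norm_partialDeriv_le (hd : Fintype.card d = 3) : ∃ C : ℝ, 0 ≤ C ∧
    ∀ B : UnitAddTorus d → EuclideanSpace ℝ d, IsSmooth B → ∀ j x,
      ‖Torus.partialDeriv j B x‖ ≤ C * Real.sqrt (latNormSq 3 B) := by
  obtain ⟨C, hC0, hC⟩ := exists_sup_norm_le (d := d) hd
  refine ⟨C * Real.sqrt (4 * Real.pi ^ 2), by positivity, fun B hB j x => ?_⟩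
  have h1 := hC (Torus.partialDeriv j B) (hB.partialDeriv j) x
  have h2 : latNormSq 2 (Torus.partialDeriv j B) ≤ 4 * Real.pi ^ 2 * latNormSq 3 B := latNormSq_partialDeriv_le hB 2 j
  calc ‖Torus.partialDeriv j B x‖ ≤ C * Real.sqrt (latNormSq 2 (Torus.partialDeriv j B)) := h1
    _ ≤ C * Real.sqrt (4 * Real.pi ^ 2 * latNormSq 3 B) := mul_le_mul_of_nonneg_left (Real.sqrt_le_sqrt h2) hC0
    _ = _ := by rw [Real.sqrt_mul (by positivity)]; ring

/-- **`‖div W‖_∞ ≤ C √(latNormSq 3 W)`** on `T³`. [folklore] -/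
theorem exists_abs_divergence_le (hd : Fintype.card d = 3) : ∃ C : ℝ, 0 ≤ C ∧
    ∀ W : UnitAddTorus d → EuclideanSpace ℝ d, IsSmooth W → ∀ x,
      |Torus.divergence W x| ≤ C * Real.sqrt (latNormSq 3 W) := by
  obtain ⟨C, hC0, hC⟩ := exists_sup_norm_partialDeriv_le (d := d) hd
  refine ⟨Fintype.card d * C, by positivity, fun W hW x => ?_⟩
  calc |Torus.divergence W x| ≤ ∑ i, ‖Torus.partialDeriv i W x‖ := abs_divergence_le_sum hW x
    _ ≤ ∑ _i : d, C * Real.sqrt (latNormSq 3 W) := sum_le_sum fun i _ => hC W hW i x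
    _ = _ := by rw [sum_const, card_univ, nsmul_eq_mul]; ring

end Sup

/-! ### Three trilinear bounds -/

section Trilinear

variable {G : Type*} [NormedAddCommGroup G] [InnerProductSpace ℝ G]

/-- `√(∫ ‖∂ⱼ B‖²) ≤ 2π √(latNormSq 1 B)`. [folklore] -/
theorem sqrt_integral_norm_sq_partialDeriv_le {B : UnitAddTorus d → EuclideanSpace ℝ d} (hB : IsSmooth B) (j : d) :
    Real.sqrt (∫ x, ‖Torus.partialDeriv j B x‖ ^ 2) ≤ Real.sqrt (4 * Real.pi ^ 2) * Real.sqrt (latNormSq 1 B) := by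
  rw [← Real.sqrt_mul (by positivity)]
  refine Real.sqrt_le_sqrt ?_
  have := integral_norm_sq_wordDeriv_le_latNormSq hB (w := [j]) (m := 1) (by simp)
  simpa using this

omit [DecidableEq d] in
/-- `√(∫ ‖A‖²) = √(latNormSq 0 A)`. [folklore] -/
theorem sqrt_integral_norm_sq_eq {A : UnitAddTorus d → EuclideanSpace ℝ d} (hA : IsSmooth A) :
    Real.sqrt (∫ x, ‖A x‖ ^ 2) = Real.sqrt (latNormSq 0 A) := by
  rw [latNormSq_zero hA]

/-- **Trilinear bound, sup on the transporting field**: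
`|∫ ⟪(A·∇)B, z⟫| ≤ C √(latNormSq 2 A) √(latNormSq 1 B) ‖z‖_{L²}`. [folklore] -/
theorem exists_trilinear_sup_left (hd : Fintype.card d = 3) : ∃ C : ℝ, 0 ≤ C ∧
    ∀ (A B : UnitAddTorus d → EuclideanSpace ℝ d) (z : UnitAddTorus d → EuclideanSpace ℝ d),
      IsSmooth A → IsSmooth B → IsSmooth z →
      |∫ x, ⟪Torus.convect A B x, z x⟫_ℝ| ≤
        C * Real.sqrt (latNormSq 2 A) * Real.sqrt (latNormSq 1 B) * Real.sqrt (∫ x, ‖z x‖ ^ 2) := by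
  obtain ⟨C, hC0, hC⟩ := exists_sup_norm_le (d := d) hd
  refine ⟨C * (Fintype.card d * Real.sqrt (4 * Real.pi ^ 2)), by positivity, fun A B z hA hB hz => ?_⟩
  have h := abs_integral_inner_convect_le_of_sup_left hB hz (hC A hA)
  have hS : ∑ j, Real.sqrt (∫ x, ‖Torus.partialDeriv j B x‖ ^ 2) * Real.sqrt (∫ x, ‖z x‖ ^ 2) ≤
      ∑ _j : d, Real.sqrt (4 * Real.pi ^ 2) * Real.sqrt (latNormSq 1 B) * Real.sqrt (∫ x, ‖z x‖ ^ 2) :=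
    sum_le_sum fun j _ => mul_le_mul_of_nonneg_right (sqrt_integral_norm_sq_partialDeriv_le hB j) (Real.sqrt_nonneg _)
  rw [sum_const, card_univ, nsmul_eq_mul] at hS
  calc |∫ x, ⟪Torus.convect A B x, z x⟫_ℝ|
      ≤ C * Real.sqrt (latNormSq 2 A) * ∑ j, Real.sqrt (∫ x, ‖Torus.partialDeriv j B x‖ ^ 2) *
          Real.sqrt (∫ x, ‖z x‖ ^ 2) := h
    _ ≤ C * Real.sqrt (latNormSq 2 A) * (Fintype.card d * (Real.sqrt (4 * Real.pi ^ 2) *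
          Real.sqrt (latNormSq 1 B) * Real.sqrt (∫ x, ‖z x‖ ^ 2))) :=
        mul_le_mul_of_nonneg_left hS (by positivity)
    _ = _ := by ring

/-- **Trilinear bound, sup on the gradient of the transported field**:
`|∫ ⟪(A·∇)B, z⟫| ≤ C √(latNormSq 0 A) √(latNormSq 3 B) ‖z‖_{L²}`. [folklore] -/
theorem exists_trilinear_sup_right (hd : Fintype.card d = 3) : ∃ C : ℝ, 0 ≤ C ∧
    ∀ (A B : UnitAddTorus d → EuclideanSpace ℝ d) (z : UnitAddTorus d → EuclideanSpace ℝ d),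
      IsSmooth A → IsSmooth B → IsSmooth z →
      |∫ x, ⟪Torus.convect A B x, z x⟫_ℝ| ≤
        C * Real.sqrt (latNormSq 0 A) * Real.sqrt (latNormSq 3 B) * Real.sqrt (∫ x, ‖z x‖ ^ 2) := by
  obtain ⟨C, hC0, hC⟩ := exists_sup_norm_partialDeriv_le (d := d) hd
  refine ⟨Fintype.card d * C, by positivity, fun A B z hA hB hz => ?_⟩
  have h := abs_integral_inner_convect_le_of_sup_right hA hB hz (W := fun _ => C * Real.sqrt (latNormSq 3 B))
    (fun j x => hC B hB j x)
  rw [sum_const, card_univ, nsmul_eq_mul, sqrt_integral_norm_sq_eq hA] at h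
  calc |∫ x, ⟪Torus.convect A B x, z x⟫_ℝ|
      ≤ Fintype.card d * (C * Real.sqrt (latNormSq 3 B)) * (Real.sqrt (latNormSq 0 A) * Real.sqrt (∫ x, ‖z x‖ ^ 2)) := h
    _ = _ := by ring

omit [DecidableEq d] in
/-- The square root of the `L⁴` bound: `√(∫ ‖A‖⁴) ≤ √K · latNormSq 1 A`. [folklore] -/
theorem sqrt_integral_norm_pow_four_le {K : ℝ} (hK0 : 0 ≤ K)
    (hK : ∀ u : UnitAddTorus d → EuclideanSpace ℝ d, IsSmooth u → ∫ x, ‖u x‖ ^ 4 ≤ K * latNormSq 1 u ^ 2)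
    {A : UnitAddTorus d → EuclideanSpace ℝ d} (hA : IsSmooth A) :
    Real.sqrt (∫ x, ‖A x‖ ^ 4) ≤ Real.sqrt K * latNormSq 1 A := by
  rw [← Real.sqrt_sq (latNormSq_nonneg 1 A), ← Real.sqrt_mul hK0]
  exact Real.sqrt_le_sqrt (hK A hA)

/-- **The `L⁴ × L⁴` product bound**: `∫ ‖A‖² ‖∂ⱼB‖² ≤ K · 4π² · latNormSq 1 A · latNormSq 2 B`
with the `L⁴` constant `K`. [folklore] -/
theorem integral_norm_sq_mul_norm_sq_partialDeriv_le {K : ℝ} (hK0 : 0 ≤ K)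
    (hK : ∀ u : UnitAddTorus d → EuclideanSpace ℝ d, IsSmooth u → ∫ x, ‖u x‖ ^ 4 ≤ K * latNormSq 1 u ^ 2)
    {A B : UnitAddTorus d → EuclideanSpace ℝ d} (hA : IsSmooth A) (hB : IsSmooth B) (j : d) :
    ∫ x, ‖A x‖ ^ 2 * ‖Torus.partialDeriv j B x‖ ^ 2 ≤ K * (4 * Real.pi ^ 2) * latNormSq 1 A * latNormSq 2 B := by
  have h1 := FunctionSpaces.Torus.integral_mul_le_sqrt_mul_sqrt_of_continuous (f := fun x => ‖A x‖ ^ 2) (g := fun x => ‖Torus.partialDeriv j B x‖ ^ 2)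
    (hA.continuous.norm.pow 2) ((hB.partialDeriv j).continuous.norm.pow 2)
    (fun x => sq_nonneg _) (fun x => sq_nonneg _)
  have eA : ∫ x, (‖A x‖ ^ 2) ^ 2 = ∫ x, ‖A x‖ ^ 4 := integral_congr_ae (ae_of_all _ fun x => by ring)
  have eB : ∫ x, (‖Torus.partialDeriv j B x‖ ^ 2) ^ 2 = ∫ x, ‖Torus.partialDeriv j B x‖ ^ 4 :=
    integral_congr_ae (ae_of_all _ fun x => by ring)
  rw [eA, eB] at h1
  have hA4 := sqrt_integral_norm_pow_four_le hK0 hK hA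
  have hB4 := sqrt_integral_norm_pow_four_le hK0 hK (hB.partialDeriv j)
  have hB2 : latNormSq 1 (Torus.partialDeriv j B) ≤ 4 * Real.pi ^ 2 * latNormSq 2 B := latNormSq_partialDeriv_le hB 1 j
  have h0A : 0 ≤ latNormSq 1 A := latNormSq_nonneg 1 A
  calc ∫ x, ‖A x‖ ^ 2 * ‖Torus.partialDeriv j B x‖ ^ 2
      ≤ Real.sqrt (∫ x, ‖A x‖ ^ 4) * Real.sqrt (∫ x, ‖Torus.partialDeriv j B x‖ ^ 4) := h1
    _ ≤ (Real.sqrt K * latNormSq 1 A) * (Real.sqrt K * latNormSq 1 (Torus.partialDeriv j B)) :=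
        mul_le_mul hA4 hB4 (Real.sqrt_nonneg _) (mul_nonneg (Real.sqrt_nonneg _) h0A)
    _ ≤ (Real.sqrt K * latNormSq 1 A) * (Real.sqrt K * (4 * Real.pi ^ 2 * latNormSq 2 B)) :=
        mul_le_mul_of_nonneg_left (mul_le_mul_of_nonneg_left hB2 (Real.sqrt_nonneg _))
          (mul_nonneg (Real.sqrt_nonneg _) h0A)
    _ = K * (4 * Real.pi ^ 2) * latNormSq 1 A * latNormSq 2 B := by
        have : Real.sqrt K * Real.sqrt K = K := Real.mul_self_sqrt hK0
        linear_combination (4 * Real.pi ^ 2 * latNormSq 1 A * latNormSq 2 B) * this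

/-- **Trilinear bound, `L⁴ × L⁴`**:
`|∫ ⟪(A·∇)B, z⟫| ≤ C √(latNormSq 1 A) √(latNormSq 2 B) ‖z‖_{L²}`. [folklore] -/
theorem exists_trilinear_L4 (hd : Fintype.card d = 3) : ∃ C : ℝ, 0 ≤ C ∧
    ∀ (A B : UnitAddTorus d → EuclideanSpace ℝ d) (z : UnitAddTorus d → EuclideanSpace ℝ d),
      IsSmooth A → IsSmooth B → IsSmooth z →
      |∫ x, ⟪Torus.convect A B x, z x⟫_ℝ| ≤
        C * Real.sqrt (latNormSq 1 A) * Real.sqrt (latNormSq 2 B) * Real.sqrt (∫ x, ‖z x‖ ^ 2) := by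
  obtain ⟨K, hK0, hK⟩ := exists_integral_norm_pow_four_le_latNormSq_one_sq (d := d) hd
  refine ⟨Fintype.card d * Real.sqrt (K * (4 * Real.pi ^ 2)), by positivity, fun A B z hA hB hz => ?_⟩
  have hB1 : IsContDiff 1 B := hB.isContDiff (by simp)
  -- pointwise: `|⟪(A·∇)B, z⟫| ≤ ∑ⱼ (‖A‖ ‖∂ⱼB‖) ‖z‖`
  have hpt : ∀ x, |⟪Torus.convect A B x, z x⟫_ℝ| ≤ ∑ j, (‖A x‖ * ‖Torus.partialDeriv j B x‖) * ‖z x‖ := by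
    intro x
    calc |⟪Torus.convect A B x, z x⟫_ℝ| ≤ ‖Torus.convect A B x‖ * ‖z x‖ := abs_real_inner_le_norm _ _
      _ ≤ (‖A x‖ * ∑ j, ‖Torus.partialDeriv j B x‖) * ‖z x‖ :=
          mul_le_mul_of_nonneg_right (norm_convect_le A hB1 x) (norm_nonneg _)
      _ = _ := by rw [mul_sum, sum_mul]
  have hint : ∀ j, Integrable (fun x => (‖A x‖ * ‖Torus.partialDeriv j B x‖) * ‖z x‖) volume := fun j =>
    ((hA.continuous.norm.mul (hB.partialDeriv j).continuous.norm).mul hz.continuous.norm).integrable_unitAddTorus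
  -- one coordinate at a time
  have hstep : ∀ j, ∫ x, (‖A x‖ * ‖Torus.partialDeriv j B x‖) * ‖z x‖ ≤
      Real.sqrt (K * (4 * Real.pi ^ 2)) * Real.sqrt (latNormSq 1 A) * Real.sqrt (latNormSq 2 B) *
        Real.sqrt (∫ x, ‖z x‖ ^ 2) := by
    intro j
    have h1 := FunctionSpaces.Torus.integral_mul_le_sqrt_mul_sqrt_of_continuous (f := fun x => ‖A x‖ * ‖Torus.partialDeriv j B x‖) (g := fun x => ‖z x‖)
      (hA.continuous.norm.mul (hB.partialDeriv j).continuous.norm)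
      hz.continuous.norm (fun x => mul_nonneg (norm_nonneg _) (norm_nonneg _)) (fun x => norm_nonneg _)
    have h2 : ∫ x, (‖A x‖ * ‖Torus.partialDeriv j B x‖) ^ 2 ≤ K * (4 * Real.pi ^ 2) * latNormSq 1 A * latNormSq 2 B := by
      have := integral_norm_sq_mul_norm_sq_partialDeriv_le hK0 hK hA hB j
      refine le_trans (le_of_eq ?_) this
      exact integral_congr_ae (ae_of_all _ fun x => by ring)
    calc ∫ x, (‖A x‖ * ‖Torus.partialDeriv j B x‖) * ‖z x‖
        ≤ Real.sqrt (∫ x, (‖A x‖ * ‖Torus.partialDeriv j B x‖) ^ 2) * Real.sqrt (∫ x, ‖z x‖ ^ 2) := h1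
      _ ≤ Real.sqrt (K * (4 * Real.pi ^ 2) * latNormSq 1 A * latNormSq 2 B) * Real.sqrt (∫ x, ‖z x‖ ^ 2) :=
          mul_le_mul_of_nonneg_right (Real.sqrt_le_sqrt h2) (Real.sqrt_nonneg _)
      _ = _ := by
          have hA0 := latNormSq_nonneg 1 A
          have hB0 := latNormSq_nonneg 2 B
          rw [Real.sqrt_mul (by positivity), Real.sqrt_mul (by positivity)]
  calc |∫ x, ⟪Torus.convect A B x, z x⟫_ℝ| ≤ ∫ x, |⟪Torus.convect A B x, z x⟫_ℝ| := abs_integral_le_integral_abs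
    _ ≤ ∫ x, ∑ j, (‖A x‖ * ‖Torus.partialDeriv j B x‖) * ‖z x‖ :=
        integral_mono_of_nonneg (ae_of_all _ fun x => abs_nonneg _) (integrable_finsetSum _ fun j _ => hint j)
          (ae_of_all _ hpt)
    _ = ∑ j, ∫ x, (‖A x‖ * ‖Torus.partialDeriv j B x‖) * ‖z x‖ := integral_finsetSum _ fun j _ => hint j
    _ ≤ ∑ _j : d, Real.sqrt (K * (4 * Real.pi ^ 2)) * Real.sqrt (latNormSq 1 A) * Real.sqrt (latNormSq 2 B) *
        Real.sqrt (∫ x, ‖z x‖ ^ 2) := sum_le_sum fun j _ => hstep j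
    _ = _ := by rw [sum_const, card_univ, nsmul_eq_mul]; ring

end Trilinear

/-! ### The tame pairing of levels -/

section Tame

variable {W U : UnitAddTorus d → EuclideanSpace ℝ d}

/-- **The tame pairing of levels**: for `3 ≤ p`, `3 ≤ q`, `p + q = m + 3`,
`latNormSq p W · latNormSq q U ≤ latNormSq 3 W · latNormSq m U + latNormSq m W · latNormSq 3 U`
(log-convexity in the level and the weighted AM–GM inequality). [folklore] -/
theorem latProd_le_tame (hW : IsSmooth W) (hU : IsSmooth U) {p q m : ℕ} (hp : 3 ≤ p) (hq : 3 ≤ q)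
    (hpq : p + q = m + 3) :
    latNormSq p W * latNormSq q U ≤ latNormSq 3 W * latNormSq m U + latNormSq m W * latNormSq 3 U := by
  have hpm : p ≤ m := by omega
  have hqm : q ≤ m := by omega
  have h3W := latNormSq_nonneg 3 W
  have hmW := latNormSq_nonneg m W
  have h3U := latNormSq_nonneg 3 U
  have hmU := latNormSq_nonneg m U
  -- the extreme cases
  rcases eq_or_lt_of_le hp with hp3 | hp3
  · -- `p = 3`, `q = m`
    subst hp3
    have hqm' : q = m := by omega
    subst hqm'
    linarith [mul_nonneg hmW h3U]
  rcases eq_or_lt_of_le hq with hq3 | hq3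
  · subst hq3
    have hpm' : p = m := by omega
    subst hpm'
    linarith [mul_nonneg h3W hmU]
  -- `3 < p, q < m`: interpolate both factors
  have hm3 : (3 : ℝ) < m := by exact_mod_cast (show 3 < m by omega)
  set θ : ℝ := ((m : ℝ) - p) / ((m : ℝ) - 3) with hθ
  have hden : (0 : ℝ) < (m : ℝ) - 3 := by linarith
  have hpm' : (p : ℝ) < m := by exact_mod_cast (show p < m by omega)
  have hp3' : (3 : ℝ) < p := by exact_mod_cast hp3
  have hθ0 : 0 < θ := div_pos (by linarith) hden
  have hθ1 : θ < 1 := by rw [hθ, div_lt_one hden]; linarith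
  -- `p = θ·3 + (1-θ)·m` and `q = (1-θ)·3 + θ·m`
  have hpθ : (p : ℝ) = θ * ((3 : ℕ) : ℝ) + (1 - θ) * ((m : ℕ) : ℝ) := by
    push_cast
    rw [hθ]
    field_simp
    ring
  have hqθ : (q : ℝ) = (1 - θ) * ((3 : ℕ) : ℝ) + (1 - (1 - θ)) * ((m : ℕ) : ℝ) := by
    have hq' : (q : ℝ) = m + 3 - p := by
      have hsum : (p : ℝ) + q = m + 3 := by exact_mod_cast hpq
      linarith
    push_cast
    rw [hq', hθ]
    field_simp
    ring
  have hIW := latNormSq_interpolate hW hθ0 hθ1 hpθ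
  have hIU := latNormSq_interpolate hU (by linarith) (by linarith) hqθ
  rw [sub_sub_cancel] at hIU
  -- Young: `a^θ b^{1-θ} · c^{1-θ} e^θ = (a e)^θ (b c)^{1-θ} ≤ θ a e + (1-θ) b c`
  have hY := Real.geom_mean_le_arith_mean2_weighted (w₁ := θ) (w₂ := 1 - θ) hθ0.le (by linarith)
    (mul_nonneg h3W hmU) (mul_nonneg hmW h3U) (by ring)
  calc latNormSq p W * latNormSq q U
      ≤ (latNormSq 3 W ^ θ * latNormSq m W ^ (1 - θ)) * (latNormSq 3 U ^ (1 - θ) * latNormSq m U ^ θ) :=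
        mul_le_mul hIW hIU (latNormSq_nonneg q U) (by positivity)
    _ = (latNormSq 3 W * latNormSq m U) ^ θ * (latNormSq m W * latNormSq 3 U) ^ (1 - θ) := by
        rw [Real.mul_rpow h3W hmU, Real.mul_rpow hmW h3U]; ring
    _ ≤ θ * (latNormSq 3 W * latNormSq m U) + (1 - θ) * (latNormSq m W * latNormSq 3 U) := hY
    _ ≤ _ := by
        nlinarith [mul_nonneg h3W hmU, mul_nonneg hmW h3U, hθ0.le]

end Tame


end Torus

end Literature.Analysis.FluidPDE
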